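import Mathlib
import HarnessLib
import Literature.Analysis.FluidPDE.MildSolution
import Literature.Analysis.UnboundedOperators.HeatKernel
import Literature.Analysis.UnboundedOperators.HeatKernelBoundedData
import Literature.Analysis.FluidPDE.NewtonKernel
import Summits.NavierStokesRegularity.NavierStokesRegularity.Theorems.QuarterLogPincerQuietCollarHeatCommutator

/-!
# Route `QuarterLogPincer`, crux `TypeIQuantSubcubicExp` (stmt-NavierStokesRegularity-24077), line `quiet_collar` — towards QP2
# (log-weighted typing `StubCutPairLog`), module M1-L³: THE HEAT COMMUTATOR IN `L³`, AGAINST THE LOCAL BUDGET PLUS A TAIL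

The sup bound of the heat commutator `H(t) = χ·e^{tΔ}f − e^{tΔ}(χf)` (`χ = radialCutoff r (r+L)`, `f = v(−1)`) is
`…QuietCollarHeatCommutator`.  The `L³` clause of QP2 asks for `‖H(t)‖₃ ≤ K₂(b+1)` where `b` only bounds the LOCALISED slices
`‖1_{B(0,R)} v(s)‖₃` — no global `L³` information on `v` is available, and the sup bound times the volume of the collar region
is unbounded in the radius.  The way out (QP2 plan, pub-ns-dss bus 2026-08-29T03:06Z) is a pointwise domination by
`L³`-controlled quantities plus a far tail:

* `norm_heatExtension_le_localised_add_tail` — for `‖x‖ ≤ ρ < R` and `f` continuous with `‖f‖ ≤ M_f`: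
  `‖e^{tΔ}f(x)‖ ≤ e^{tΔ}g(x) + M_f·m₁(t)/(R − ρ)`, `g = 1_{B(0,R)}‖f‖`, `m₁(t) = 2·2^{n/2}√t ≥ ∫G_t(y)‖y‖dy` (Chebyshev on
  the first moment of the heat kernel: the mass of `G_t` beyond distance `R − ρ` is `≤ m₁(t)/(R−ρ)`);
* `norm_heatCommutator_le_pointwise` — `‖H(t,x)‖ ≤ ‖e^{tΔ}(χf)(x)‖ + 1_{B̄(0,r+L)}(x)·(e^{tΔ}g(x) + M_f·m₁(t)/(R−r−L))`;
* `eLpNorm_heatCommutator_three_le` — **`‖H(t)‖₃ ≤ 2‖1_{B(0,R)}f‖₃ + M_f·m₁(t)/(R−r−L)·|B̄(0,r+L)|^{1/3}`** (`L³`-contractivity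
  of the heat semigroup `eLpNorm_heatExtension_le`, twice).  With `R − (r+L) ≳ (r+L)²` (the QP2 choice of the radius) the
  tail term is `≤ C·M_f`, uniformly in `r`.

r-INDEPENDENT groundwork for QP2 (DIRECTOR-NS KEY-NS #187).  HONEST FRAME: an elementary heat-kernel estimate; nothing here bears
on 24077, W7 or Navier–Stokes regularity (OPEN).  pub-ns-dss typer (g37), `--supports 24077`.
-/

noncomputable section

set_option linter.dupNamespace false

namespace Summit.NavierStokesRegularity.NavierStokesRegularity.Cruxes.TypeIQuantSubcubicExp.QuietCollar

open MeasureTheory Set Function Filter Real Metric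
open scoped ENNReal NNReal Topology
open Literature.Analysis Literature.Analysis.FluidPDE Literature.Analysis.UnboundedOperators

/-- The first-moment constant of the heat kernel on `ℝ³`: `m₁(t) = 2·2^{n/2}·t^{1/2}` (`∫G_t(y)‖y‖dy ≤ m₁(t)`,
`integral_heatKernel_mul_norm_le`). [folklore] -/
theorem heatMoment_nonneg (t : ℝ) (ht : 0 ≤ t) :
    0 ≤ 2 * (2 : ℝ) ^ ((Module.finrank ℝ (EuclideanSpace ℝ (Fin 3)) : ℝ) / 2) * t ^ (1 / 2 : ℝ) := by
  have : 0 ≤ t ^ (1 / 2 : ℝ) := Real.rpow_nonneg ht _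
  positivity

/-- **LOCALISATION OF THE HEAT EXTENSION WITH A CHEBYSHEV TAIL**: for `f` continuous with `‖f‖ ≤ M_f`, `0 < t`, `‖x‖ ≤ ρ < R`,
`‖e^{tΔ}f(x)‖ ≤ e^{tΔ}g(x) + M_f·m₁(t)/(R − ρ)` where `g = 1_{B(0,R)}‖f‖` (pointwise `‖f(x−y)‖ ≤ g(x−y) + M_f‖y‖/(R−ρ)`: if
`x − y ∉ B(0,R)` then `‖y‖ ≥ R − ρ`). [folklore] -/
theorem norm_heatExtension_le_localised_add_tail {f : EuclideanSpace ℝ (Fin 3) → EuclideanSpace ℝ (Fin 3)} {Mf t ρ R : ℝ}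
    (hf : Continuous f) (hMf : ∀ z, ‖f z‖ ≤ Mf) (ht : 0 < t) (hρR : ρ < R) {x : EuclideanSpace ℝ (Fin 3)} (hx : ‖x‖ ≤ ρ) :
    ‖heatExtension f t x‖ ≤
      heatExtension (fun y => (Metric.ball (0 : EuclideanSpace ℝ (Fin 3)) R).indicator (fun y => ‖f y‖) y) t x +
        Mf * (2 * (2 : ℝ) ^ ((Module.finrank ℝ (EuclideanSpace ℝ (Fin 3)) : ℝ) / 2) * t ^ (1 / 2 : ℝ)) / (R - ρ) := by
  have hMf0 : 0 ≤ Mf := (norm_nonneg _).trans (hMf 0)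
  have hd : 0 < R - ρ := sub_pos.2 hρR
  set g : EuclideanSpace ℝ (Fin 3) → ℝ := fun y => (Metric.ball (0 : EuclideanSpace ℝ (Fin 3)) R).indicator (fun y => ‖f y‖) y
    with hg
  have hgm : Measurable g := (continuous_norm.comp hf).measurable.indicator measurableSet_ball
  have hg0 : ∀ y, 0 ≤ g y := fun y => by
    rw [hg]; exact Set.indicator_nonneg (fun _ _ => norm_nonneg _) _
  have hgle : ∀ y, g y ≤ Mf := fun y => by
    rw [hg]; exact Set.indicator_le' (fun _ _ => hMf _) (fun _ _ => hMf0) _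
  -- integrability of the three integrands
  have hGi : Integrable (heatKernel (E := EuclideanSpace ℝ (Fin 3)) t) := integrable_heatKernel_holds ht
  have hi1 : Integrable (fun y => heatKernel t y • f (x - y)) := integrable_heatKernel_smul_of_bound hf hMf ht x
  have hi2 : Integrable (fun y => heatKernel t y * g (x - y)) := by
    refine hGi.mul_bdd (c := Mf) (hgm.comp (measurable_const.sub measurable_id)).aestronglyMeasurable
      (Eventually.of_forall fun y => ?_)
    rw [Real.norm_of_nonneg (hg0 _)]; exact hgle _
  have hi3 : Integrable (fun y : EuclideanSpace ℝ (Fin 3) => heatKernel t y * ‖y‖ * (Mf / (R - ρ))) :=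
    (integrable_heatKernel_mul_norm ht).mul_const _
  -- pointwise domination
  have hpt : ∀ y, ‖heatKernel t y • f (x - y)‖ ≤ heatKernel t y * g (x - y) + heatKernel t y * ‖y‖ * (Mf / (R - ρ)) := by
    intro y
    have hG0 : 0 ≤ heatKernel t y := (heatKernel_pos ht y).le
    rw [norm_smul, Real.norm_of_nonneg hG0]
    have key : ‖f (x - y)‖ ≤ g (x - y) + ‖y‖ * (Mf / (R - ρ)) := by
      by_cases hxy : x - y ∈ Metric.ball (0 : EuclideanSpace ℝ (Fin 3)) R
      · simp only [hg, Set.indicator_of_mem hxy]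
        have : 0 ≤ ‖y‖ * (Mf / (R - ρ)) := by positivity
        linarith
      · simp only [hg, Set.indicator_of_notMem hxy, zero_add]
        rw [Metric.mem_ball, dist_zero_right, not_lt] at hxy
        have hy : R - ρ ≤ ‖y‖ := by
          have h2 : ‖x - y‖ ≤ ‖x‖ + ‖y‖ := norm_sub_le x y
          linarith
        calc ‖f (x - y)‖ ≤ Mf := hMf _
          _ = (R - ρ) * (Mf / (R - ρ)) := by field_simp
          _ ≤ ‖y‖ * (Mf / (R - ρ)) := mul_le_mul_of_nonneg_right hy (by positivity)
    calc heatKernel t y * ‖f (x - y)‖ ≤ heatKernel t y * (g (x - y) + ‖y‖ * (Mf / (R - ρ))) :=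
          mul_le_mul_of_nonneg_left key hG0
      _ = heatKernel t y * g (x - y) + heatKernel t y * ‖y‖ * (Mf / (R - ρ)) := by ring
  rw [heatExtension_apply, heatExtension_apply]
  calc ‖∫ y, heatKernel t y • f (x - y)‖ ≤ ∫ y, ‖heatKernel t y • f (x - y)‖ := norm_integral_le_integral_norm _
    _ ≤ ∫ y, (heatKernel t y * g (x - y) + heatKernel t y * ‖y‖ * (Mf / (R - ρ))) :=
        integral_mono hi1.norm (hi2.add hi3) hpt
    _ = (∫ y, heatKernel t y * g (x - y)) + (∫ y, heatKernel t y * ‖y‖) * (Mf / (R - ρ)) := by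
        rw [integral_add hi2 hi3, integral_mul_const]
    _ ≤ (∫ y, heatKernel t y * g (x - y)) +
          (2 * (2 : ℝ) ^ ((Module.finrank ℝ (EuclideanSpace ℝ (Fin 3)) : ℝ) / 2) * t ^ (1 / 2 : ℝ)) * (Mf / (R - ρ)) := by
        have := mul_le_mul_of_nonneg_right (integral_heatKernel_mul_norm_le (E := EuclideanSpace ℝ (Fin 3)) ht)
          (by positivity : 0 ≤ Mf / (R - ρ))
        linarith
    _ = (∫ y, heatKernel t y • g (x - y)) +
          Mf * (2 * (2 : ℝ) ^ ((Module.finrank ℝ (EuclideanSpace ℝ (Fin 3)) : ℝ) / 2) * t ^ (1 / 2 : ℝ)) / (R - ρ) := by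
        simp only [smul_eq_mul]; ring

/-- **POINTWISE DOMINATION OF THE HEAT COMMUTATOR**: with `χ = radialCutoff r (r+L)` (`0 ≤ r`, `0 < L`), `f` continuous with
`‖f‖ ≤ M_f`, `0 < t` and `r + L < R`,
`‖χ(x)e^{tΔ}f(x) − e^{tΔ}(χf)(x)‖ ≤ ‖e^{tΔ}(χf)(x)‖ + 1_{B̄(0,r+L)}(x)·(e^{tΔ}g(x) + M_f·m₁(t)/(R−r−L))`, `g = 1_{B(0,R)}‖f‖`
(`0 ≤ χ ≤ 1_{B̄(0,r+L)}` and the localisation lemma at `ρ = r + L`). [folklore] -/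
theorem norm_heatCommutator_le_pointwise {f : EuclideanSpace ℝ (Fin 3) → EuclideanSpace ℝ (Fin 3)} {Mf t r L R : ℝ}
    (hf : Continuous f) (hMf : ∀ z, ‖f z‖ ≤ Mf) (ht : 0 < t) (hr : 0 ≤ r) (hL : 0 < L) (hR : r + L < R)
    (x : EuclideanSpace ℝ (Fin 3)) :
    ‖radialCutoff r (r + L) x • heatExtension f t x - heatExtension (fun y => radialCutoff r (r + L) y • f y) t x‖ ≤
      ‖heatExtension (fun y => radialCutoff r (r + L) y • f y) t x‖ +
        (Metric.closedBall (0 : EuclideanSpace ℝ (Fin 3)) (r + L)).indicator (fun _ => (1 : ℝ)) x *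
          (heatExtension (fun y => (Metric.ball (0 : EuclideanSpace ℝ (Fin 3)) R).indicator (fun y => ‖f y‖) y) t x +
            Mf * (2 * (2 : ℝ) ^ ((Module.finrank ℝ (EuclideanSpace ℝ (Fin 3)) : ℝ) / 2) * t ^ (1 / 2 : ℝ)) / (R - (r + L))) := by
  have hMf0 : 0 ≤ Mf := (norm_nonneg _).trans (hMf 0)
  have hrR : r < r + L := by linarith
  set g : EuclideanSpace ℝ (Fin 3) → ℝ := fun y => (Metric.ball (0 : EuclideanSpace ℝ (Fin 3)) R).indicator (fun y => ‖f y‖) y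
    with hg
  -- `e^{tΔ}g ≥ 0`
  have hg0 : ∀ y, 0 ≤ g y := fun y => by
    rw [hg]; exact Set.indicator_nonneg (fun _ _ => norm_nonneg _) _
  have hEg0 : 0 ≤ heatExtension g t x := by
    rw [heatExtension_apply]
    exact integral_nonneg fun y => by
      simp only [smul_eq_mul]; exact mul_nonneg (heatKernel_pos ht y).le (hg0 _)
  have hm₁ := heatMoment_nonneg t ht.le
  have htail0 : 0 ≤ Mf * (2 * (2 : ℝ) ^ ((Module.finrank ℝ (EuclideanSpace ℝ (Fin 3)) : ℝ) / 2) * t ^ (1 / 2 : ℝ)) /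
      (R - (r + L)) := by
    have : 0 < R - (r + L) := by linarith
    positivity
  calc ‖radialCutoff r (r + L) x • heatExtension f t x - heatExtension (fun y => radialCutoff r (r + L) y • f y) t x‖
      ≤ ‖radialCutoff r (r + L) x • heatExtension f t x‖ + ‖heatExtension (fun y => radialCutoff r (r + L) y • f y) t x‖ :=
        norm_sub_le _ _
    _ = ‖heatExtension (fun y => radialCutoff r (r + L) y • f y) t x‖ + radialCutoff r (r + L) x * ‖heatExtension f t x‖ := by
        rw [norm_smul, Real.norm_of_nonneg (radialCutoff_nonneg _ _ _), add_comm]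
    _ ≤ _ := by
        gcongr ‖heatExtension (fun y => radialCutoff r (r + L) y • f y) t x‖ + ?_
        by_cases hx : x ∈ Metric.closedBall (0 : EuclideanSpace ℝ (Fin 3)) (r + L)
        · rw [Set.indicator_of_mem hx, one_mul]
          rw [Metric.mem_closedBall, dist_zero_right] at hx
          calc radialCutoff r (r + L) x * ‖heatExtension f t x‖ ≤ 1 * ‖heatExtension f t x‖ :=
                mul_le_mul_of_nonneg_right (radialCutoff_le_one _ _ _) (norm_nonneg _)
            _ = ‖heatExtension f t x‖ := one_mul _
            _ ≤ _ := norm_heatExtension_le_localised_add_tail hf hMf ht hR hx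
        · rw [Set.indicator_of_notMem hx, zero_mul]
          rw [Metric.mem_closedBall, dist_zero_right, not_le] at hx
          rw [radialCutoff_eq_zero hr hrR hx.le, zero_mul]

/-- **THE HEAT COMMUTATOR IN `L³`**: with `χ = radialCutoff r (r+L)` (`0 ≤ r`, `0 < L`), `f` continuous with `‖f‖ ≤ M_f`,
`0 < t`, `r + L < R`:
`‖χ·e^{tΔ}f − e^{tΔ}(χf)‖_{L³} ≤ 2·‖1_{B(0,R)}f‖_{L³} + M_f·m₁(t)/(R−r−L)·|B̄(0,r+L)|^{1/3}`
(the pointwise domination, `L³`-contractivity of `e^{tΔ}` for `χf` and for `g = 1_{B(0,R)}‖f‖`, both dominated by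
`1_{B(0,R)}‖f‖`, and `‖1_{B̄(0,r+L)}‖₃ = |B̄(0,r+L)|^{1/3}`). [folklore] -/
theorem eLpNorm_heatCommutator_three_le {f : EuclideanSpace ℝ (Fin 3) → EuclideanSpace ℝ (Fin 3)} {Mf t r L R : ℝ}
    (hf : Continuous f) (hMf : ∀ z, ‖f z‖ ≤ Mf) (ht : 0 < t) (hr : 0 ≤ r) (hL : 0 < L) (hR : r + L < R) :
    eLpNorm (fun x => radialCutoff r (r + L) x • heatExtension f t x -
        heatExtension (fun y => radialCutoff r (r + L) y • f y) t x) 3 volume ≤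
      2 * eLpNorm ((Metric.ball (0 : EuclideanSpace ℝ (Fin 3)) R).indicator f) 3 volume +
        ENNReal.ofReal (Mf * (2 * (2 : ℝ) ^ ((Module.finrank ℝ (EuclideanSpace ℝ (Fin 3)) : ℝ) / 2) * t ^ (1 / 2 : ℝ)) /
            (R - (r + L))) *
          volume (Metric.closedBall (0 : EuclideanSpace ℝ (Fin 3)) (r + L)) ^ (1 / (3 : ℝ)) := by
  have hMf0 : 0 ≤ Mf := (norm_nonneg _).trans (hMf 0)
  have hrR : r < r + L := by linarith
  have hd : 0 < R - (r + L) := by linarith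
  set χ : EuclideanSpace ℝ (Fin 3) → ℝ := radialCutoff r (r + L) with hχ
  set g : EuclideanSpace ℝ (Fin 3) → ℝ := fun y => (Metric.ball (0 : EuclideanSpace ℝ (Fin 3)) R).indicator (fun y => ‖f y‖) y
    with hg
  set θ : ℝ := Mf * (2 * (2 : ℝ) ^ ((Module.finrank ℝ (EuclideanSpace ℝ (Fin 3)) : ℝ) / 2) * t ^ (1 / 2 : ℝ)) / (R - (r + L))
    with hθ
  have hθ0 : 0 ≤ θ := by have := heatMoment_nonneg t ht.le; positivity
  set fR : EuclideanSpace ℝ (Fin 3) → EuclideanSpace ℝ (Fin 3) := (Metric.ball (0 : EuclideanSpace ℝ (Fin 3)) R).indicator f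
    with hfR
  -- measurability / integrability facts
  have hχc : Continuous χ := (radialCutoff_contDiff r (r + L) (n := 0)).continuous
  have hχf : Continuous fun y => χ y • f y := hχc.smul hf
  have hχfc : HasCompactSupport fun y => χ y • f y := (hasCompactSupport_radialCutoff hr hrR).smul_right
  have hχf_mem : MemLp (fun y => χ y • f y) 3 volume := hχf.memLp_of_hasCompactSupport hχfc
  have hfR_meas : AEStronglyMeasurable fR volume := (hf.aestronglyMeasurable).indicator measurableSet_ball
  have hfR_mem : MemLp fR 3 volume := by
    refine MemLp.of_le (memLp_indicator_const 3 (measurableSet_ball (x := (0 : EuclideanSpace ℝ (Fin 3))) (ε := R)) Mf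
      (Or.inr measure_ball_lt_top.ne)) hfR_meas (Eventually.of_forall fun y => ?_)
    by_cases hy : y ∈ Metric.ball (0 : EuclideanSpace ℝ (Fin 3)) R
    · simp only [hfR, Set.indicator_of_mem hy, Real.norm_of_nonneg hMf0]; exact hMf y
    · simp only [hfR, Set.indicator_of_notMem hy, norm_zero, le_rfl]
  have hg_eq : g = fun y => ‖fR y‖ := by
    funext y
    by_cases hy : y ∈ Metric.ball (0 : EuclideanSpace ℝ (Fin 3)) R
    · simp only [hg, hfR, Set.indicator_of_mem hy]
    · simp only [hg, hfR, Set.indicator_of_notMem hy, norm_zero]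
  have hg_mem : MemLp g 3 volume := by rw [hg_eq]; exact hfR_mem.norm
  have hg_norm : eLpNorm g 3 volume = eLpNorm fR 3 volume := by rw [hg_eq]; exact eLpNorm_norm fR
  have hχf_le : eLpNorm (fun y => χ y • f y) 3 volume ≤ eLpNorm fR 3 volume := by
    refine eLpNorm_mono fun y => ?_
    by_cases hy : y ∈ Metric.ball (0 : EuclideanSpace ℝ (Fin 3)) R
    · rw [hfR, Set.indicator_of_mem hy, norm_smul, Real.norm_of_nonneg (radialCutoff_nonneg _ _ _)]
      exact mul_le_of_le_one_left (norm_nonneg _) (radialCutoff_le_one _ _ _)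
    · rw [hfR, Set.indicator_of_notMem hy, norm_zero]
      rw [Metric.mem_ball, dist_zero_right, not_lt] at hy
      rw [hχ, radialCutoff_eq_zero hr hrR (le_of_lt (lt_of_lt_of_le hR hy)), zero_smul, norm_zero]
  -- the three dominating pieces
  set P₁ : EuclideanSpace ℝ (Fin 3) → EuclideanSpace ℝ (Fin 3) := fun x => heatExtension (fun y => χ y • f y) t x with hP₁
  set P₂ : EuclideanSpace ℝ (Fin 3) → ℝ := fun x =>
    (Metric.closedBall (0 : EuclideanSpace ℝ (Fin 3)) (r + L)).indicator (fun _ => (1 : ℝ)) x * heatExtension g t x with hP₂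
  set P₃ : EuclideanSpace ℝ (Fin 3) → ℝ := fun x =>
    (Metric.closedBall (0 : EuclideanSpace ℝ (Fin 3)) (r + L)).indicator (fun _ => θ) x with hP₃
  have hP₁_le : eLpNorm P₁ 3 volume ≤ eLpNorm fR 3 volume :=
    (eLpNorm_heatExtension_le_holds hχf_mem (by norm_num) ht).trans hχf_le
  have hEg_le : eLpNorm (heatExtension g t) 3 volume ≤ eLpNorm fR 3 volume :=
    (eLpNorm_heatExtension_le_holds hg_mem (by norm_num) ht).trans hg_norm.le
  have hP₂_le : eLpNorm P₂ 3 volume ≤ eLpNorm fR 3 volume := by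
    refine (eLpNorm_mono fun x => ?_).trans hEg_le
    rw [hP₂]
    by_cases hx : x ∈ Metric.closedBall (0 : EuclideanSpace ℝ (Fin 3)) (r + L)
    · simp only [Set.indicator_of_mem hx, one_mul, le_rfl]
    · simp only [Set.indicator_of_notMem hx, zero_mul, norm_zero, norm_nonneg]
  have hP₃_eq : eLpNorm P₃ 3 volume =
      ENNReal.ofReal θ * volume (Metric.closedBall (0 : EuclideanSpace ℝ (Fin 3)) (r + L)) ^ (1 / (3 : ℝ)) := by
    rw [hP₃, eLpNorm_indicator_const measurableSet_closedBall (by norm_num) (by norm_num), Real.enorm_eq_ofReal hθ0]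
    norm_num
  -- measurability of the pieces (for the triangle inequality)
  have hEg_meas : AEStronglyMeasurable (heatExtension g t) volume :=
    (memLp_heatExtension_holds hg_mem (by norm_num) ht).aestronglyMeasurable
  have hP₁_meas : AEStronglyMeasurable P₁ volume :=
    (memLp_heatExtension_holds hχf_mem (by norm_num) ht).aestronglyMeasurable
  have hP₂_meas : AEStronglyMeasurable P₂ volume :=
    ((aestronglyMeasurable_const.indicator measurableSet_closedBall).mul hEg_meas)
  have hP₃_meas : AEStronglyMeasurable P₃ volume := aestronglyMeasurable_const.indicator measurableSet_closedBall
  -- pointwise domination by `‖P₁‖ + (P₂ + P₃)`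
  have hdom : ∀ x, ‖χ x • heatExtension f t x - heatExtension (fun y => χ y • f y) t x‖ ≤ ‖P₁ x‖ + ‖P₂ x + P₃ x‖ := by
    intro x
    have h := norm_heatCommutator_le_pointwise (R := R) hf hMf ht hr hL hR x
    refine h.trans (add_le_add le_rfl ?_)
    rw [hP₂, hP₃]
    by_cases hx : x ∈ Metric.closedBall (0 : EuclideanSpace ℝ (Fin 3)) (r + L)
    · simp only [Set.indicator_of_mem hx, one_mul]
      exact le_abs_self _
    · simp only [Set.indicator_of_notMem hx, zero_mul, add_zero, norm_zero, le_rfl]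
  have h3 : (1 : ℝ≥0∞) ≤ 3 := by norm_num
  have hsum_meas : AEStronglyMeasurable (fun x => P₂ x + P₃ x) volume := hP₂_meas.add hP₃_meas
  calc eLpNorm (fun x => χ x • heatExtension f t x - heatExtension (fun y => χ y • f y) t x) 3 volume
      ≤ eLpNorm (fun x => ‖P₁ x‖ + ‖P₂ x + P₃ x‖) 3 volume := eLpNorm_mono_real fun x => hdom x
    _ ≤ eLpNorm (fun x => ‖P₁ x‖) 3 volume + eLpNorm (fun x => ‖P₂ x + P₃ x‖) 3 volume :=
        eLpNorm_add_le hP₁_meas.norm hsum_meas.norm h3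
    _ = eLpNorm P₁ 3 volume + eLpNorm (fun x => P₂ x + P₃ x) 3 volume := by rw [eLpNorm_norm, eLpNorm_norm]
    _ ≤ eLpNorm P₁ 3 volume + (eLpNorm P₂ 3 volume + eLpNorm P₃ 3 volume) :=
        add_le_add le_rfl (eLpNorm_add_le hP₂_meas hP₃_meas h3)
    _ ≤ eLpNorm fR 3 volume + (eLpNorm fR 3 volume +
          ENNReal.ofReal θ * volume (Metric.closedBall (0 : EuclideanSpace ℝ (Fin 3)) (r + L)) ^ (1 / (3 : ℝ))) :=
        add_le_add hP₁_le (add_le_add hP₂_le hP₃_eq.le)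
    _ = _ := by rw [hθ]; ring

end Summit.NavierStokesRegularity.NavierStokesRegularity.Cruxes.TypeIQuantSubcubicExp.QuietCollar

end
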